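import Literature.Topology.FourManifolds.KirbyMovesSlideEndThickeningDeriv
import HarnessLib

/-!
# Normalising the band end: the thickening read in a stereographic chart

Topic `Literature/Topology/FourManifolds`; fact seat `provefact-IsStrictHandleSlide.isSurgery`
(R. C. Kirby, *The Topology of 4-Manifolds*, LNM 1374 (1989), Ch. I §4; remaining content: the
named fact (S) `Literature.Topology.FourManifolds.FramedLink.IsStrictHandleSlide.slideModel`).
Following the uniqueness of tubular neighbourhoods (`LinkTubularUniqueness.lean`: straight-line
isotopy extension in a stereographic chart `σ = σ : S³ ∖ {pt} ≅ ℝ³`), the flattening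
of the band end is constructed in `ℝ³` from the **thickening read in the chart**,
`f (x, z) = σ (thickening (x, z)) = F₃ (Ξ₀ (x, z))` with `F₃ (θ, w) = σ (ν (circlePt θ, w))` and
the thickening coordinates `Ξ₀` of `KirbyMovesSlideEndThickeningDeriv.lean`. Proved here (no
definitions, no named facts):

* `BandCore.contDiffOn_tubeChart` — `F₃` is `C^∞` on `{(θ, w) | ν (circlePt θ, w) ∈ σ.source}`;
* `BandCore.injective_fderiv_tubeChart` — `D F₃` is injective at every such point (a local
  smooth left inverse: the fixed-centre angle lift of `KirbyMovesSlideEndData2.lean` composed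
  with `ν⁻¹ ∘ σ⁻¹`);
* `BandCore.contDiffOn_thickeningChart` — `f` is `C^∞` on `baseLiftDom × ℝ` (when `ν (S¹ × ℝ²) ⊆ σ.source`);
* `BandCore.exists_equiv_hasFDerivAt_thickeningChart` — at an edge point `((1, y), 0)` where the
  band leaves `Kⱼ'` radially (`D W (1, y) (1, 0) = -c • e₀`, `c ≠ 0`) the derivative of `f` is a
  linear isomorphism `ℝ² × ℝ ≅ ℝ³`.

## References

* R. C. Kirby, *The Topology of 4-Manifolds*, LNM 1374, Springer (1989), Ch. I §4. [Kirby1989]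
* A. Kosinski, *Differential Manifolds* (1993), Ch. III, Thm. (3.5). [Kosinski1993]
-/

open scoped Manifold ContDiff Topology
open Function Set Metric

noncomputable section

namespace Literature.Topology.FourManifolds

namespace BandCore

variable [Knot.TubularNbhd.SmoothnessFacts] {A Kj : Knot} (ν : Knot.TubularNbhd Kj)
  {avoid : Set (Metric.sphere (0 : EuclideanSpace ℝ (Fin 4)) 1)} (b : BandCore A ν.pushOff avoid)
  {σ : OpenPartialHomeomorph (Metric.sphere (0 : EuclideanSpace ℝ (Fin 4)) 1) (EuclideanSpace ℝ (Fin 3))}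

omit [Knot.TubularNbhd.SmoothnessFacts] in
/-- **The tube in the chart is smooth**: `F₃ (θ, w) = σ (ν (circlePt θ, w))` is `C^∞` on the open
set of `(θ, w)` with `ν (circlePt θ, w) ∈ σ.source`. [folklore] -/
theorem contDiffOn_tubeChart (hσ : ContMDiffOn (𝓡 3) 𝓘(ℝ, EuclideanSpace ℝ (Fin 3)) ∞ σ σ.source) :
    ContDiffOn ℝ ∞ (fun q : ℝ × EuclideanSpace ℝ (Fin 2) ↦ σ (ν (circlePt q.1, q.2)))
      {q | ν (circlePt q.1, q.2) ∈ σ.source} := by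
  have h1 : ContMDiff (𝓘(ℝ, ℝ).prod 𝓘(ℝ, EuclideanSpace ℝ (Fin 2))) ((𝓡 1).prod 𝓘(ℝ, EuclideanSpace ℝ (Fin 2))) ∞
      (fun q : ℝ × EuclideanSpace ℝ (Fin 2) ↦ ((circlePt q.1, q.2) :
        Metric.sphere (0 : EuclideanSpace ℝ (Fin 2)) 1 × EuclideanSpace ℝ (Fin 2))) :=
    (contMDiff_circlePt.comp contMDiff_fst).prodMk contMDiff_snd
  have h2 : ContMDiff (𝓘(ℝ, ℝ).prod 𝓘(ℝ, EuclideanSpace ℝ (Fin 2))) (𝓡 3) ∞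
      (fun q : ℝ × EuclideanSpace ℝ (Fin 2) ↦ ν (circlePt q.1, q.2)) := ν.contMDiff.comp h1
  have h3 := (hσ).comp h2.contMDiffOn (fun q hq ↦ hq)
  rw [← modelWithCornersSelf_prod, chartedSpaceSelf_prod] at h3
  exact contMDiffOn_iff_contDiffOn.1 h3

omit [Knot.TubularNbhd.SmoothnessFacts] in
/-- The domain of the tube chart is open. [folklore] -/
theorem isOpen_tubeChartDom :
    IsOpen {q : ℝ × EuclideanSpace ℝ (Fin 2) | ν (circlePt q.1, q.2) ∈ σ.source} := by
  have hc : Continuous (fun q : ℝ × EuclideanSpace ℝ (Fin 2) ↦ ν (circlePt q.1, q.2)) :=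
    ν.continuous.comp ((continuous_circlePt.comp continuous_fst).prodMk continuous_snd)
  exact σ.open_source.preimage hc

omit [Knot.TubularNbhd.SmoothnessFacts] in
/-- **The differential of the tube chart is injective.** At a point `(θ₀, w₀)` of its domain,
`D F₃ (θ₀, w₀)` is injective: near `F₃ (θ₀, w₀)` the map
`G₃ = (θ₀/(2π)-recentred angle lift ∘ pr₁ ∘ ν⁻¹ ∘ σ⁻¹, pr₂ ∘ ν⁻¹ ∘ σ⁻¹)` is a smooth left inverse
of `F₃` near `(θ₀, w₀)`. [folklore] -/
theorem injective_fderiv_tubeChart (hσ : ContMDiffOn (𝓡 3) 𝓘(ℝ, EuclideanSpace ℝ (Fin 3)) ∞ σ σ.source)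
    (hσs : ContMDiff 𝓘(ℝ, EuclideanSpace ℝ (Fin 3)) (𝓡 3) ∞ σ.symm) {θ₀ : ℝ} {w₀ : EuclideanSpace ℝ (Fin 2)}
    (h₀ : ν (circlePt θ₀, w₀) ∈ σ.source) :
    Injective (fderiv ℝ (fun q : ℝ × EuclideanSpace ℝ (Fin 2) ↦ σ (ν (circlePt q.1, q.2))) (θ₀, w₀)) := by
  haveI := fact_finrank_euclideanSpace_succ 1
  -- notation: `F₃`, the coordinates `Uc`, `Wc` of `ν⁻¹ ∘ σ⁻¹`, the angle argument and `G₃`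
  obtain ⟨F₃, hF₃⟩ : ∃ F₃ : ℝ × EuclideanSpace ℝ (Fin 2) → EuclideanSpace ℝ (Fin 3),
      F₃ = fun q ↦ σ (ν (circlePt q.1, q.2)) := ⟨_, rfl⟩
  obtain ⟨Uc, hUc⟩ : ∃ Uc : EuclideanSpace ℝ (Fin 3) → EuclideanSpace ℝ (Fin 2),
      Uc = fun p ↦ ((ν.toTubeNbhd.toHomeo.symm (σ.symm p)).1 : EuclideanSpace ℝ (Fin 2)) := ⟨_, rfl⟩
  obtain ⟨Wc, hWc⟩ : ∃ Wc : EuclideanSpace ℝ (Fin 3) → EuclideanSpace ℝ (Fin 2),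
      Wc = fun p ↦ (ν.toTubeNbhd.toHomeo.symm (σ.symm p)).2 := ⟨_, rfl⟩
  obtain ⟨arg, harg⟩ : ∃ arg : EuclideanSpace ℝ (Fin 3) → ℝ,
      arg = fun p ↦ Real.cos (2 * Real.pi * θ₀) * Uc p 1 - Real.sin (2 * Real.pi * θ₀) * Uc p 0 := ⟨_, rfl⟩
  obtain ⟨G₃, hG₃⟩ : ∃ G₃ : EuclideanSpace ℝ (Fin 3) → ℝ × EuclideanSpace ℝ (Fin 2),
      G₃ = fun p ↦ (θ₀ + (2 * Real.pi)⁻¹ * Real.arcsin (arg p), Wc p) := ⟨_, rfl⟩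
  obtain ⟨p₀, hp₀⟩ : ∃ p₀ : EuclideanSpace ℝ (Fin 3), p₀ = σ (ν (circlePt θ₀, w₀)) := ⟨_, rfl⟩
  -- smoothness of `ν⁻¹ ∘ σ⁻¹` near `p₀`
  have hσsymm : ContMDiff 𝓘(ℝ, EuclideanSpace ℝ (Fin 3)) (𝓡 3) ∞ σ.symm := hσs
  have hback : σ.symm p₀ = ν (circlePt θ₀, w₀) := by rw [hp₀]; exact σ.left_inv h₀
  have hrange : IsOpen (σ.symm ⁻¹' range ⇑ν) := ν.toTubeNbhd.isOpen_range.preimage hσsymm.continuous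
  have hp₀r : p₀ ∈ σ.symm ⁻¹' range ⇑ν := by
    show σ.symm p₀ ∈ range ⇑ν; rw [hback]; exact mem_range_self _
  have hcoord : ContMDiffOn 𝓘(ℝ, EuclideanSpace ℝ (Fin 3)) ((𝓡 1).prod 𝓘(ℝ, EuclideanSpace ℝ (Fin 2))) ∞
      (fun p ↦ ν.toTubeNbhd.toHomeo.symm (σ.symm p)) (σ.symm ⁻¹' range ⇑ν) :=
    ν.toTubeNbhd.contMDiffOn_toHomeo_symm.comp hσsymm.contMDiffOn (fun p hp ↦ by simpa using hp)
  have hUcs : ContDiffOn ℝ ∞ Uc (σ.symm ⁻¹' range ⇑ν) := by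
    rw [hUc]
    exact contMDiffOn_iff_contDiffOn.1 ((contMDiff_coe_sphere (n := 1)).comp_contMDiffOn
      (contMDiff_fst.comp_contMDiffOn hcoord))
  have hWcs : ContDiffOn ℝ ∞ Wc (σ.symm ⁻¹' range ⇑ν) := by
    rw [hWc]; exact contMDiffOn_iff_contDiffOn.1 (contMDiff_snd.comp_contMDiffOn hcoord)
  -- values at `p₀`
  have hcoord₀ : ν.toTubeNbhd.toHomeo.symm (σ.symm p₀) = (circlePt θ₀, w₀) := by
    rw [hback]
    have := ν.toTubeNbhd.toHomeo_symm_apply (circlePt θ₀, w₀)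
    simpa using this
  have hUc₀ : Uc p₀ = ((circlePt θ₀ : Metric.sphere (0 : EuclideanSpace ℝ (Fin 2)) 1) : EuclideanSpace ℝ (Fin 2)) := by
    rw [hUc]; simp only [hcoord₀]
  have harg₀ : arg p₀ = 0 := by
    rw [harg]; simp only [hUc₀, circlePt_apply_zero, circlePt_apply_one]; ring
  -- `G₃` is differentiable at `p₀`
  have hUcd : ContDiffAt ℝ ∞ Uc p₀ := hUcs.contDiffAt (hrange.mem_nhds hp₀r)
  have hWcd : ContDiffAt ℝ ∞ Wc p₀ := hWcs.contDiffAt (hrange.mem_nhds hp₀r)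
  have hargs : ContDiffAt ℝ ∞ arg p₀ := by
    have h0 : ContDiffAt ℝ ∞ (fun p ↦ Uc p 0) p₀ := (contDiff_euclidean.1 contDiff_id 0).contDiffAt.comp p₀ hUcd
    have h1 : ContDiffAt ℝ ∞ (fun p ↦ Uc p 1) p₀ := (contDiff_euclidean.1 contDiff_id 1).contDiffAt.comp p₀ hUcd
    rw [harg]
    exact (contDiffAt_const.mul h1).sub (contDiffAt_const.mul h0)
  have hG₃d : DifferentiableAt ℝ G₃ p₀ := by
    have ha : ContDiffAt ℝ ∞ Real.arcsin (arg p₀) := by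
      rw [harg₀]; exact Real.contDiffAt_arcsin (by norm_num) (by norm_num)
    have h1 : ContDiffAt ℝ ∞ (fun p ↦ θ₀ + (2 * Real.pi)⁻¹ * Real.arcsin (arg p)) p₀ :=
      contDiffAt_const.add (contDiffAt_const.mul (ha.comp p₀ hargs))
    rw [hG₃]
    exact (h1.prodMk hWcd).differentiableAt (by simp)
  -- `F₃` is differentiable at `(θ₀, w₀)`
  have hdom : IsOpen {q : ℝ × EuclideanSpace ℝ (Fin 2) | ν (circlePt q.1, q.2) ∈ σ.source} :=
    isOpen_tubeChartDom ν (σ := σ)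
  have hmem : {q : ℝ × EuclideanSpace ℝ (Fin 2) | ν (circlePt q.1, q.2) ∈ σ.source} ∈ 𝓝 (θ₀, w₀) :=
    hdom.mem_nhds h₀
  have hF₃d : DifferentiableAt ℝ F₃ (θ₀, w₀) := by
    rw [hF₃]
    exact ((contDiffOn_tubeChart ν hσ).contDiffAt hmem).differentiableAt (by simp)
  -- `G₃ ∘ F₃ = id` near `(θ₀, w₀)`
  have hclose : ∀ᶠ q : ℝ × EuclideanSpace ℝ (Fin 2) in 𝓝 (θ₀, w₀), |2 * Real.pi * q.1 - 2 * Real.pi * θ₀| < Real.pi / 2 := by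
    have hc : Continuous (fun q : ℝ × EuclideanSpace ℝ (Fin 2) ↦ |2 * Real.pi * q.1 - 2 * Real.pi * θ₀|) := by fun_prop
    have h := hc.continuousAt (x := (θ₀, w₀))
    have h0 : (fun q : ℝ × EuclideanSpace ℝ (Fin 2) ↦ |2 * Real.pi * q.1 - 2 * Real.pi * θ₀|) (θ₀, w₀) = 0 := by simp
    exact h.eventually (p := fun r ↦ r < Real.pi / 2) (by rw [h0]; exact Iio_mem_nhds (by positivity))
  have hev : ∀ᶠ q : ℝ × EuclideanSpace ℝ (Fin 2) in 𝓝 (θ₀, w₀), G₃ (F₃ q) = q := by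
    filter_upwards [hclose, hmem] with q hq hqdom
    have hbackq : σ.symm (F₃ q) = ν (circlePt q.1, q.2) := by
      rw [hF₃]; exact σ.left_inv hqdom
    have hcq : ν.toTubeNbhd.toHomeo.symm (σ.symm (F₃ q)) = (circlePt q.1, q.2) := by
      rw [hbackq]
      have := ν.toTubeNbhd.toHomeo_symm_apply (circlePt q.1, q.2)
      simpa using this
    have hUq : Uc (F₃ q) = ((circlePt q.1 : Metric.sphere (0 : EuclideanSpace ℝ (Fin 2)) 1) : EuclideanSpace ℝ (Fin 2)) := by
      rw [hUc]; simp only [hcq]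
    have hWq : Wc (F₃ q) = q.2 := by rw [hWc]; simp only [hcq]
    have hargq : arg (F₃ q) = Real.sin (2 * Real.pi * q.1 - 2 * Real.pi * θ₀) := by
      rw [harg]
      simp only [hUq, circlePt_apply_zero, circlePt_apply_one, Real.sin_sub]
      ring
    rw [hG₃]
    obtain ⟨q1, q2⟩ := q
    simp only [hWq, Prod.mk.injEq, and_true]
    rw [hargq, Real.arcsin_sin (by linarith [(abs_lt.1 hq).1]) (by linarith [(abs_lt.1 hq).2])]
    field_simp
    ring
  -- differentiate `G₃ ∘ F₃ = id`
  have hp₀' : F₃ (θ₀, w₀) = p₀ := by rw [hF₃, hp₀]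
  have hG₃d' : DifferentiableAt ℝ G₃ (F₃ (θ₀, w₀)) := by rw [hp₀']; exact hG₃d
  have hcomp := hG₃d'.hasFDerivAt.comp (θ₀, w₀) hF₃d.hasFDerivAt
  have hid : HasFDerivAt (G₃ ∘ F₃) (ContinuousLinearMap.id ℝ _) (θ₀, w₀) :=
    (hasFDerivAt_id (θ₀, w₀)).congr_of_eventuallyEq (hev.mono fun q hq ↦ hq)
  have heq := hcomp.unique hid
  have hF₃' : fderiv ℝ (fun q : ℝ × EuclideanSpace ℝ (Fin 2) ↦ σ (ν (circlePt q.1, q.2))) (θ₀, w₀) =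
      fderiv ℝ F₃ (θ₀, w₀) := by rw [hF₃]
  rw [hF₃']
  intro v v' hvv
  have := congrArg (fderiv ℝ G₃ (F₃ (θ₀, w₀))) hvv
  have h1 := ContinuousLinearMap.ext_iff.1 heq v
  have h2 := ContinuousLinearMap.ext_iff.1 heq v'
  simp only [ContinuousLinearMap.coe_comp, comp_apply, ContinuousLinearMap.id_apply] at h1 h2
  rw [← h1, ← h2, this]

/-- **The thickening read in the chart is smooth** on `baseLiftDom × ℝ`, if `ν (S¹ × ℝ²) ⊆ σ.source`.
[folklore] -/
theorem contDiffOn_thickeningChart (hσ : ContMDiffOn (𝓡 3) 𝓘(ℝ, EuclideanSpace ℝ (Fin 3)) ∞ σ σ.source)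
    (hνσ : ∀ q, ν q ∈ σ.source) :
    ContDiffOn ℝ ∞ (fun p : EuclideanSpace ℝ (Fin 2) × ℝ ↦ σ (b.thickening ν p)) ((b.baseLiftDom ν) ×ˢ univ) := by
  have hsrc : ∀ p, b.thickening ν p ∈ σ.source := fun p ↦ hνσ _
  have h := (hσ).comp (b.contMDiffOn_thickening ν) (fun p _ ↦ hsrc p)
  exact contMDiffOn_iff_contDiffOn.1 h

/-- **The derivative of the thickening in the chart at an edge point is an isomorphism** when the
band leaves the push-off radially there (`D W (1, y) (1, 0) = -c • e₀`, `c ≠ 0`): it is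
`D F₃ ∘ D Ξ₀` with both factors injective, between spaces of dimension `3`. [folklore] -/
theorem exists_equiv_hasFDerivAt_thickeningChart (hσ : ContMDiffOn (𝓡 3) 𝓘(ℝ, EuclideanSpace ℝ (Fin 3)) ∞ σ σ.source)
    (hσs : ContMDiff 𝓘(ℝ, EuclideanSpace ℝ (Fin 3)) (𝓡 3) ∞ σ.symm) (hνσ : ∀ q, ν q ∈ σ.source) {y : ℝ} (hy : y ∈ Ioo (10⁻¹ : ℝ) (9 / 10))
    {c : ℝ} (hc : c ≠ 0) (hA : fderiv ℝ (b.tubeNormal ν) (pt2 1 y) (pt2 1 0) = (-c) • framingBaseVector) :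
    ∃ L : (EuclideanSpace ℝ (Fin 2) × ℝ) ≃L[ℝ] EuclideanSpace ℝ (Fin 3),
      HasFDerivAt (fun p : EuclideanSpace ℝ (Fin 2) × ℝ ↦ σ (b.thickening ν p))
        (L : (EuclideanSpace ℝ (Fin 2) × ℝ) →L[ℝ] EuclideanSpace ℝ (Fin 3)) (pt2 1 y, 0) := by
  have hfac : (fun p : EuclideanSpace ℝ (Fin 2) × ℝ ↦ σ (b.thickening ν p)) =
      (fun q : ℝ × EuclideanSpace ℝ (Fin 2) ↦ σ (ν (circlePt q.1, q.2))) ∘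
        (fun p : EuclideanSpace ℝ (Fin 2) × ℝ ↦ ((b.baseLift ν p.1,
          b.tubeNormal ν p.1 + p.2 • EuclideanSpace.single (1 : Fin 2) (1 : ℝ)) : ℝ × EuclideanSpace ℝ (Fin 2))) := by
    funext p; rfl
  have hx : (pt2 1 y : EuclideanSpace ℝ (Fin 2)) ∈ b.baseLiftDom ν := b.pt2_one_mem_baseLiftDom' ν hy
  -- derivative of the thickening coordinates at `((1, y), 0)`
  have hΞ := b.hasFDerivAt_thickeningCoord ν hx 0
  have hΞinj := b.injective_fderiv_thickeningCoord ν hy hc hA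
  -- derivative of the tube chart at the image point `q₀ = Ξ₀ ((1, y), 0)`
  have hsrc : ν (circlePt (b.baseLift ν (pt2 1 y)),
      b.tubeNormal ν (pt2 1 y) + (0 : ℝ) • EuclideanSpace.single (1 : Fin 2) (1 : ℝ)) ∈ σ.source := hνσ _
  have hdom : IsOpen {q : ℝ × EuclideanSpace ℝ (Fin 2) | ν (circlePt q.1, q.2) ∈ σ.source} :=
    isOpen_tubeChartDom ν (σ := σ)
  have hmem : {q : ℝ × EuclideanSpace ℝ (Fin 2) | ν (circlePt q.1, q.2) ∈ σ.source} ∈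
      𝓝 ((b.baseLift ν (pt2 1 y), b.tubeNormal ν (pt2 1 y) + (0 : ℝ) • EuclideanSpace.single (1 : Fin 2) (1 : ℝ)) :
        ℝ × EuclideanSpace ℝ (Fin 2)) := hdom.mem_nhds hsrc
  have hF₃d : DifferentiableAt ℝ (fun q : ℝ × EuclideanSpace ℝ (Fin 2) ↦ σ (ν (circlePt q.1, q.2)))
      ((b.baseLift ν (pt2 1 y), b.tubeNormal ν (pt2 1 y) + (0 : ℝ) • EuclideanSpace.single (1 : Fin 2) (1 : ℝ)) :
        ℝ × EuclideanSpace ℝ (Fin 2)) :=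
    ((contDiffOn_tubeChart ν hσ).contDiffAt hmem).differentiableAt (by simp)
  have hF₃inj := injective_fderiv_tubeChart ν hσ hσs hsrc
  -- chain rule
  have hcomp := hF₃d.hasFDerivAt.comp ((pt2 1 y : EuclideanSpace ℝ (Fin 2)), (0 : ℝ)) hΞ
  have hMinj : Injective ((fderiv ℝ (fun q : ℝ × EuclideanSpace ℝ (Fin 2) ↦ σ (ν (circlePt q.1, q.2)))
      ((b.baseLift ν (pt2 1 y), b.tubeNormal ν (pt2 1 y) + (0 : ℝ) • EuclideanSpace.single (1 : Fin 2) (1 : ℝ)) :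
        ℝ × EuclideanSpace ℝ (Fin 2))).comp
      (((fderiv ℝ (b.baseLift ν) (pt2 1 y)).comp (ContinuousLinearMap.fst ℝ _ ℝ)).prod
        ((fderiv ℝ (b.tubeNormal ν) (pt2 1 y)).comp (ContinuousLinearMap.fst ℝ _ ℝ) +
          (ContinuousLinearMap.snd ℝ (EuclideanSpace ℝ (Fin 2)) ℝ).smulRight (EuclideanSpace.single (1 : Fin 2) (1 : ℝ))))) :=
    hF₃inj.comp hΞinj
  have hdim : Module.finrank ℝ (EuclideanSpace ℝ (Fin 2) × ℝ) = Module.finrank ℝ (EuclideanSpace ℝ (Fin 3)) := by simp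
  refine ⟨(LinearMap.linearEquivOfInjective _ hMinj hdim).toContinuousLinearEquiv, ?_⟩
  have hcoe : (((LinearMap.linearEquivOfInjective _ hMinj hdim).toContinuousLinearEquiv :
      (EuclideanSpace ℝ (Fin 2) × ℝ) ≃L[ℝ] EuclideanSpace ℝ (Fin 3)) : (EuclideanSpace ℝ (Fin 2) × ℝ) →L[ℝ] EuclideanSpace ℝ (Fin 3)) =
      (fderiv ℝ (fun q : ℝ × EuclideanSpace ℝ (Fin 2) ↦ σ (ν (circlePt q.1, q.2)))
      ((b.baseLift ν (pt2 1 y), b.tubeNormal ν (pt2 1 y) + (0 : ℝ) • EuclideanSpace.single (1 : Fin 2) (1 : ℝ)) :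
        ℝ × EuclideanSpace ℝ (Fin 2))).comp
      (((fderiv ℝ (b.baseLift ν) (pt2 1 y)).comp (ContinuousLinearMap.fst ℝ _ ℝ)).prod
        ((fderiv ℝ (b.tubeNormal ν) (pt2 1 y)).comp (ContinuousLinearMap.fst ℝ _ ℝ) +
          (ContinuousLinearMap.snd ℝ (EuclideanSpace ℝ (Fin 2)) ℝ).smulRight (EuclideanSpace.single (1 : Fin 2) (1 : ℝ)))) :=
    ContinuousLinearMap.ext fun v ↦ rfl
  rw [hcoe, hfac]
  exact hcomp

end BandCore

end Literature.Topology.FourManifolds
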